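import Summits.CriticalPhenomena.PercolationContinuityZ3.Theorems.PercNearOneGluingNoHeavyLowerTailSahiConditioningPenalty
import Summits.CriticalPhenomena.PercolationContinuityZ3.Theorems.PercNearOneGluingNoHeavyLowerTailSahiHalfCoSingletonComparable
import Mathlib.Tactic.Linarith
import Mathlib.Tactic.Ring
import HarnessLib

/-!
# `NoHeavyLowerTail` (stmt-CriticalPhenomena-4575) — comparable pairs: conditioning on ANY set of coordinates at most doubles `E₃`

Support file, seat `prim-l12-p5` (gen 3), `--supports stmt-CriticalPhenomena-4575`.  No definitions, no named facts, no sorries.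

Combines the conditioning-penalty theorem (`SahiSubsetChord.sectionSum_le_sahiE_add_slot`: for every coordinate set `S`,
`Z_S := Σ_v w_S(v)·E₃(sections at x_S = v) ≤ E₃ + E F_a·Cov(F_b,F_c)`) with the closed form for a comparable pair
(`SahiCoSingleton.sahiE_three_eq_of_le`: `f ≤ g ⇒ E₃(f,g,h) = (2 − E g)·Cov(f,h) + E f·E[h(1−g)] ≥ E g·Cov(f,h)`):

* **`sectionSum_le_two_mul_sahiE_of_slot_le`** — for monotone `{0,1}`-valued `f ≤ g`, any monotone `{0,1}`-valued `h`, every product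
  weight and EVERY `S`: `Z_S ≤ 2·E₃(f,g,h)`;
* **`sectionSum_le_two_mul_sahiE_of_comparable`** — the same for a monotone indicator triple with a comparable pair in any two slots.

So on the comparable-pair class conditioning on any set of coordinates at most doubles the expected `E₃`: the half-co-singleton bound
(`coSingletonSum_le_two_mul_sahiE_of_comparable`, `S = univ ∖ {j}`), its all-but-two version HC₂ and every `|Sᶜ| ≥ 3` analogue hold
there with the same constant `2`, whereas for general triples `Z_S/E₃` is unbounded already for `|Sᶜ| = 3` (P5-REPORT §3h(t):
`([x₃],[x₀x₁∨x₁x₂∨x₁x₃],[x₀x₁∨x₂∨x₀x₃])` at `q = (1/2,49/50,199/200,19/20)`, ratio `200` — an antichain triple, as it must be).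
Exact check (seat, `code/hc_allS_comparable.py`): all comparable-pair triples on `k ≤ 4` coins, all `S`, 7 weight vectors incl. the
two-scale corners: `sup Z_S/E₃ = 1.9952 < 2`.
-/

namespace Summit.CriticalPhenomena.PercolationContinuityZ3.Theorems

namespace SahiCoSingleton

open Finset Literature.Combinatorics.Sahi2008 SahiSubsetChord

variable {ι : Type*} [Fintype ι] [DecidableEq ι]

/-- **Comparable pair: conditioning on any coordinate set at most doubles `E₃`.**  For monotone `{0,1}`-valued `f ≤ g`, any
monotone `{0,1}`-valued `h`, every product weight and every `S`:
`Σ_v w_S(v)·E₃(sections of (f,g,h) at x_S = v) ≤ 2·E₃(f,g,h)`. [this file] -/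
theorem sectionSum_le_two_mul_sahiE_of_slot_le (q : ι → ℝ) (hq : ∀ i, 0 ≤ q i ∧ q i ≤ 1) (f g h : (ι → Bool) → ℝ)
    (hf01 : ∀ x, f x = 0 ∨ f x = 1) (hg01 : ∀ x, g x = 0 ∨ g x = 1) (hh01 : ∀ x, h x = 0 ∨ h x = 1)
    (hfm : Monotone f) (hgm : Monotone g) (hhm : Monotone h) (hfg : ∀ x, f x ≤ g x) (S : Finset ι) :
    ∑ v : ({i // i ∈ S} → Bool), prodWeight (fun i : {i // i ∈ S} => q i) v *
        sahiE (prodWeight fun i : {i // i ∉ S} => q i) 3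
          (fun a y => (![f, g, h] : Fin 3 → (ι → Bool) → ℝ) a (glue S v y))
      ≤ 2 * sahiE (prodWeight q) 3 ![f, g, h] := by
  have hF0 : ∀ a x, 0 ≤ (![f, g, h] : Fin 3 → (ι → Bool) → ℝ) a x := by
    intro a x; fin_cases a
    · rcases hf01 x with e | e <;> simp [e]
    · rcases hg01 x with e | e <;> simp [e]
    · rcases hh01 x with e | e <;> simp [e]
  have hFm : ∀ a, Monotone ((![f, g, h] : Fin 3 → (ι → Bool) → ℝ) a) := by
    intro a; fin_cases a
    · exact hfm
    · exact hgm
    · exact hhm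
  have hf0 : ∀ x, 0 ≤ f x := fun x => by rcases hf01 x with e | e <;> simp [e]
  have hg1 : ∀ x, g x ≤ 1 := fun x => by rcases hg01 x with e | e <;> simp [e]
  have hh0 : ∀ x, 0 ≤ h x := fun x => by rcases hh01 x with e | e <;> simp [e]
  -- the conditioning penalty with the slot of `g` distinguished
  have key := sectionSum_le_sahiE_add_slot q hq (![f, g, h] : Fin 3 → (ι → Bool) → ℝ) hF0 hFm (Equiv.swap 0 1) S
  rw [show (Equiv.swap (0 : Fin 3) 1) 0 = 1 by decide, show (Equiv.swap (0 : Fin 3) 1) 1 = 0 by decide,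
    show (Equiv.swap (0 : Fin 3) 1) 2 = 2 by decide] at key
  simp only [Matrix.cons_val_zero, Matrix.cons_val_one, Matrix.head_cons, Matrix.cons_val_two, Matrix.tail_cons] at key
  -- the closed form: E₃ = (2 − b)(A − ac) + a(c − B) ≥ b(A − ac)
  have hE3 := sahiE_three_eq_of_le (prodWeight q) f g h hf01 hg1 hfg
  have hFKG : IsFKGMeasure (prodWeight q) := isFKGMeasure_coinWeight hq
  have hsum1 : ∑ x, prodWeight q x = 1 := sum_coinWeight q
  have hAc : ex (prodWeight q) f * ex (prodWeight q) h ≤ ex (prodWeight q) (f * h) :=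
    ex_mul_ex_le_ex_mul hFKG hf0 hh0 hfm hhm
  have hcB : ex (prodWeight q) (g * h) ≤ ex (prodWeight q) h :=
    ex_mono (fun x => prodWeight_nonneg hq x) fun x => mul_le_of_le_one_left (hh0 _) (hg1 _)
  have ha0 : 0 ≤ ex (prodWeight q) f := ex_nonneg (fun x => prodWeight_nonneg hq x) hf0
  have hb1 : ex (prodWeight q) g ≤ 1 := by
    have := ex_mono (μ := prodWeight q) (fun x => prodWeight_nonneg hq x) hg1
    rwa [ex_const hsum1] at this
  have t1 : 0 ≤ (1 - ex (prodWeight q) g) * (ex (prodWeight q) (f * h) - ex (prodWeight q) f * ex (prodWeight q) h) :=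
    mul_nonneg (sub_nonneg.mpr hb1) (sub_nonneg.mpr hAc)
  have t2 : 0 ≤ ex (prodWeight q) f * (ex (prodWeight q) h - ex (prodWeight q) (g * h)) :=
    mul_nonneg ha0 (sub_nonneg.mpr hcB)
  rw [hE3] at key ⊢
  linarith [key, t1, t2]

/-- **Comparable pair in any position, any conditioning set.**  For a monotone `{0,1}`-valued triple `f` on a finite product cube in
which some two slots are comparable (`f a ≤ f b`, `a ≠ b`) and every set `S` of coordinates:
`Σ_v w_S(v)·E₃(sections at x_S = v) ≤ 2·E₃(f)`. [this file] -/
theorem sectionSum_le_two_mul_sahiE_of_comparable (q : ι → ℝ) (hq : ∀ i, 0 ≤ q i ∧ q i ≤ 1)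
    (f : Fin 3 → (ι → Bool) → ℝ) (hind : ∀ a x, f a x = 0 ∨ f a x = 1) (hmono : ∀ a, Monotone (f a))
    {a b : Fin 3} (hab : a ≠ b) (hle : ∀ x, f a x ≤ f b x) (S : Finset ι) :
    ∑ v : ({i // i ∈ S} → Bool), prodWeight (fun i : {i // i ∈ S} => q i) v *
        sahiE (prodWeight fun i : {i // i ∉ S} => q i) 3 (fun a y => f a (glue S v y))
      ≤ 2 * sahiE (prodWeight q) 3 f := by
  -- reduction to the displayed order through a permutation of the slots
  have main : ∀ σ : Equiv.Perm (Fin 3), (∀ x, f (σ 0) x ≤ f (σ 1) x) →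
      ∑ v : ({i // i ∈ S} → Bool), prodWeight (fun i : {i // i ∈ S} => q i) v *
          sahiE (prodWeight fun i : {i // i ∉ S} => q i) 3 (fun a y => f a (glue S v y))
        ≤ 2 * sahiE (prodWeight q) 3 f := by
    intro σ hσ
    have key := sectionSum_le_two_mul_sahiE_of_slot_le q hq (f (σ 0)) (f (σ 1)) (f (σ 2)) (hind _) (hind _)
      (hind _) (hmono _) (hmono _) (hmono _) hσ S
    have hfσ : (fun i => f (σ i)) = ![f (σ 0), f (σ 1), f (σ 2)] := by
      funext i; fin_cases i <;> rfl
    have hsecσ : ∀ v : ({i // i ∈ S} → Bool),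
        sahiE (prodWeight fun i : {i // i ∉ S} => q i) 3
            (fun a y => (![f (σ 0), f (σ 1), f (σ 2)] : Fin 3 → (ι → Bool) → ℝ) a (glue S v y))
          = sahiE (prodWeight fun i : {i // i ∉ S} => q i) 3 (fun a y => f a (glue S v y)) := by
      intro v
      rw [← hfσ]
      exact sahiE_comp_perm _ 3 σ (fun a y => f a (glue S v y))
    simp only [hsecσ] at key
    rw [← hfσ, sahiE_comp_perm (prodWeight q) 3 σ f] at key
    exact key
  -- the six ordered cases
  fin_cases a <;> fin_cases b
  · exact absurd rfl hab
  · exact main (Equiv.refl _) hle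
  · refine main (Equiv.swap 1 2) (fun x => ?_)
    rw [show (Equiv.swap (1 : Fin 3) 2) 0 = 0 by decide, show (Equiv.swap (1 : Fin 3) 2) 1 = 2 by decide]
    exact hle x
  · refine main (Equiv.swap 0 1) (fun x => ?_)
    rw [show (Equiv.swap (0 : Fin 3) 1) 0 = 1 by decide, show (Equiv.swap (0 : Fin 3) 1) 1 = 0 by decide]
    exact hle x
  · exact absurd rfl hab
  · refine main ((Equiv.swap 0 1).trans (Equiv.swap 0 2)) (fun x => ?_)
    rw [show ((Equiv.swap (0 : Fin 3) 1).trans (Equiv.swap 0 2)) 0 = 1 by decide,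
      show ((Equiv.swap (0 : Fin 3) 1).trans (Equiv.swap 0 2)) 1 = 2 by decide]
    exact hle x
  · refine main ((Equiv.swap 0 1).trans (Equiv.swap 1 2)) (fun x => ?_)
    rw [show ((Equiv.swap (0 : Fin 3) 1).trans (Equiv.swap 1 2)) 0 = 2 by decide,
      show ((Equiv.swap (0 : Fin 3) 1).trans (Equiv.swap 1 2)) 1 = 0 by decide]
    exact hle x
  · refine main (Equiv.swap 0 2) (fun x => ?_)
    rw [show (Equiv.swap (0 : Fin 3) 2) 0 = 2 by decide, show (Equiv.swap (0 : Fin 3) 2) 1 = 1 by decide]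
    exact hle x
  · exact absurd rfl hab

end SahiCoSingleton

end Summit.CriticalPhenomena.PercolationContinuityZ3.Theorems
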